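import Summits.ResolutionOfSingularities.ResolutionOfSingularities.Theorems.FrobeniusLadderFRationalResolutionBlowupFlatCriteria
import Mathlib.RingTheory.Localization.Away.Basic
import HarnessLib

/-!
# Crux `FrobeniusLadder.FRationalResolution` (stmt-ResolutionOfSingularities-15317), line `redirect`,
# stub `stub_diagonalizableQuotientResolution` — regularity of an affine blow-up is ZARISKI-LOCAL ON THE BASE
# (local-to-global), the gluing step for centres assembled from finitely many primary pieces

`…BlowupFlatCriteria` (✓) proved the two one-cover forms: regularity of `Bl_I(Spec B)` RESTRICTS to `Bl_{IB_h}` (open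
immersion) and DESCENDS along ONE flat ring map with surjective spectrum map. The Galois route to the twisted isolated
case (`…GaloisStableCentre.hasResolution_of_galois_stable_centres`, this generation) needs the local-to-global form: the
Galois-stable centre `J ⊆ B ⊗_K K'` is the intersection of the primary centres at the finitely many points over `𝔭`, and
its blow-up is regular because it is so on a basic open cover of the base.

* **`isRegular_affineBlowup_of_forall_exists_away`** — `B` Noetherian, `I ⊆ B`: if every prime `P` has some `g ∉ P`
  with `Bl_{I B_g}(Spec B_g)` regular, then `Bl_I(Spec B)` is regular (`IsBlowup.isRegular_of_flat_cover` for the flat,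
  jointly surjective family `Spec B_{g_P} → Spec B`, blow-ups being unique);
* `isRegular_affineBlowup_of_forall_maximal_exists_away` — the same with the hypothesis at MAXIMAL ideals only.

Honest label: generic plumbing (no stub closed by name). No definitions, no named facts, no sorry.
[cite: GortzWedhorn2020, Prop. 13.91 (2)] [cite: Matsumura1987, Thm. 23.7 (i)] [cite: StacksProject, Tag 02NS]
-/

noncomputable section

-- single-problem summit: the doubled namespace component is forced
set_option linter.dupNamespace false

open CategoryTheory AlgebraicGeometry
open Literature.AlgebraicGeometry.Resolution
open Summit.ResolutionOfSingularities.ResolutionOfSingularities.Theorems.FRationalResolution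

namespace Summit.ResolutionOfSingularities.ResolutionOfSingularities.Theorems.FRationalResolution.BlowupRegularZariskiLocal

/-- **Regularity of `Bl_I(Spec B)` is Zariski-local on the base (local-to-global).** Let `B` be Noetherian and
`I ⊆ B`. If for every prime `P` there is `g ∉ P` such that `Bl_{I B_g}(Spec B_g)` is regular, then `Bl_I(Spec B)` is
regular. [cite: GortzWedhorn2020, Prop. 13.91 (2)] [cite: Matsumura1987, Thm. 23.7 (i)] -/
theorem isRegular_affineBlowup_of_forall_exists_away {B : Type} [CommRing B] [IsNoetherianRing B] (I : Ideal B)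
    (h : ∀ (P : Ideal B) [P.IsPrime], ∃ g : B, g ∉ P ∧
      Scheme.IsRegular (affineBlowup (I.map (algebraMap B (Localization.Away g))))) :
    Scheme.IsRegular (affineBlowup I) := by
  classical
  -- choose the basic open around each point
  have hch : ∀ x : PrimeSpectrum B, ∃ g : B, g ∉ x.asIdeal ∧
      Scheme.IsRegular (affineBlowup (I.map (algebraMap B (Localization.Away g)))) := fun x => h x.asIdeal
  choose g hg hreg using hch
  haveI : IsLocallyNoetherian (affineBlowup I) :=
    LocallyOfFiniteType.isLocallyNoetherian (affineBlowup.π I)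
  haveI : ∀ x : PrimeSpectrum B,
      IsOpenImmersion (Spec.map (CommRingCat.ofHom (algebraMap B (Localization.Away (g x))))) :=
    fun x => IsOpenImmersion.of_isLocalization (g x)
  refine (affineBlowup.isBlowup I).isRegular_of_flat_cover
    (e := fun x : PrimeSpectrum B => Spec.map (CommRingCat.ofHom (algebraMap B (Localization.Away (g x))))) ?_ ?_
  · -- jointly surjective: `x ∈ D(g x)` is the image of `Spec B_{g x}`
    intro x
    have hx : x ∈ Set.range (PrimeSpectrum.comap (algebraMap B (Localization.Away (g x)))) := by
      rw [PrimeSpectrum.localization_away_comap_range (Localization.Away (g x)) (g x)]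
      exact (PrimeSpectrum.mem_basicOpen _ _).mpr (hg x)
    obtain ⟨y, hy⟩ := hx
    exact ⟨x, y, hy⟩
  · intro x P q hq
    rw [BlowupFlatCriteria.idealSheaf_comap_specMap] at hq
    obtain ⟨e, -, -⟩ := (affineBlowup.isBlowup (I.map (algebraMap B (Localization.Away (g x))))).unique hq
    exact Scheme.IsRegular.of_iso e.hom (hreg x)

/-- **The same with the hypothesis at maximal ideals only**: if every MAXIMAL `𝔪` has some `g ∉ 𝔪` with
`Bl_{I B_g}(Spec B_g)` regular, then `Bl_I(Spec B)` is regular (a prime lies in some maximal ideal, and `g ∉ 𝔪 ⊇ P`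
gives `g ∉ P`). [cite: GortzWedhorn2020, Prop. 13.91 (2)] -/
theorem isRegular_affineBlowup_of_forall_maximal_exists_away {B : Type} [CommRing B] [IsNoetherianRing B]
    (I : Ideal B)
    (h : ∀ (𝔪 : Ideal B) [𝔪.IsMaximal], ∃ g : B, g ∉ 𝔪 ∧
      Scheme.IsRegular (affineBlowup (I.map (algebraMap B (Localization.Away g))))) :
    Scheme.IsRegular (affineBlowup I) := by
  refine isRegular_affineBlowup_of_forall_exists_away I fun P hP => ?_
  obtain ⟨𝔪, h𝔪, hP𝔪⟩ := Ideal.exists_le_maximal P hP.ne_top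
  obtain ⟨g, hg, hreg⟩ := @h 𝔪 h𝔪
  exact ⟨g, fun hgP => hg (hP𝔪 hgP), hreg⟩

end Summit.ResolutionOfSingularities.ResolutionOfSingularities.Theorems.FRationalResolution.BlowupRegularZariskiLocal

end
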